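import Summits.QuantumFields.BalabanUV.Beta.FP.RelInvPeriodisedMinOp

/-!
# `BalabanUV.Beta.FP.RelInvPeriodisedMinOpRecord` — road «FP» (binder row D1), ROUTE T row **(T-INV)**, sequel of `RelInvPeriodisedMinOp` (same unit, same day):
# THE MIXED (FIELD × MULTIPLIER) BLOCKS OF THE INVERSE OF THE COMB-SLICED PERIODISED LEVEL-`j` SYSTEM — the `μ`-columns of the
# minimiser `minOp` and the `μ`-rows of its left companion `minOpL` — AT THE PRESENTATION OF RECORD (the comb mask is an2's live indicator `axEc`)

HONEST DEPENDENCY (page 1, mandatory): continuum YM on T⁴ ⇐ BetaPertH ∧ nine spine estimates (0/9 proved); BetaPertH ⇐ (D1) ∧ (D4) ∧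
CAP+tail; G-an2-4 gates asym, D1 and NE2/3/4.  HONEST FRAMING (cell contract, verbatim): «discharging `BetaPertH` makes Bałaban's UV
stability UNCONDITIONAL — a real constructive-QFT result; it is NOT the continuum limit and NOT the Clay problem.»  ABSOLUTE RULE (cell
charter, verbatim): «No internally-minted statement may enter as a cited fact. Every hypothesis is either kernel-proved in this package or a
verbatim quotation of a PUBLISHED theorem with page reference. The manuscript(s) under audit are NOT citable for their own disputed steps — they
are the thing under adjudication; programme-internal (2001/route/tribunal) claims are never citable.»  THIS MODULE is [folklore] bookkeeping BY
NAME over `RelInvPeriodisedSliced.torus_sliced_kkt` ∕ `torus_isUnit_det_kkt_of_slots` (p309426: the inverse of the torus sliced KKT on the LIVE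
slots is `+Â` on field rows, `−Â` on multiplier rows, `Â := perF M (coDressKBmAt (toSite r) Lc (KInvStep Lc j))`) and the comb bookkeeping of
`RelInvPeriodisedEffForm.effForm_toBlocks₁₁_eq_perF_KInvStep` (p314950).  No `Prop`, no `def`, nothing cited, 0 sorry.  «not in print; our bookkeeping».

WHY (leaf-05 g26, for the (T-INV) ∕ (T-ID) junction at ORDER 1).  The torus call's coarse first jet is the `μμ` block of the effective-form jet word
`(L·H₁ − S·B)·I − L·Bᵀ·S` (`I = minOp`, `L = minOpL`, `S = effForm` of the fine sliced system, `B = [Q₁₁; 0]`); its `μμ` block only sees the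
`μ`-COLUMNS of `I`, the `μ`-ROWS of `L` and `S₁₁` (`CoarseJetOrderOne.orderOne_word_toBlocks₁₁`).  `S₁₁` is p314950's (E); this file supplies the
other two blocks, so that the dictionary's order-1 identification `hId₁` becomes ONE explicit sandwich identity between periodised kernels.

CONTENT (§3 of the pair; §1–§2 are in `FP/RelInvPeriodisedMinOp`).
* `comb_presentation` (the comb bookkeeping of p314950's (E), stated once: an injective comb map `cb` with `τ₁ = [· = cb ·]` on the field slots and
  an2's `axEc` as the live reading), `comb_mask_eq_axEc_mul` (`(if (s,α) ∈ range cb then 0 else X) = axEc s s (inl α) (inl α) · X`);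
* at the presentation of record (fields `(s, α) ↦ (s, inl α)` of the box `M`, `Lc ∣ Mᵢ`, `τ₁ := combRowsT (toSite r) Lc M` on the field slots,
  coarse multipliers by any injective `inr`-valued `fμ` with `hcoarse`): **`torus_minOp_inl`** ∕ **`torus_minOpL_inl`** — the `μ`-column ∕ `μ`-row
  entries of `minOp` ∕ `minOpL` are `axEc (toSite r) Lc s s (inl α) (inl α) · (+Â ∕ −Â)` (`1` on non-comb field slots, `0` on comb slots) — and the
  matrix forms **`torus_minOp_submatrix_inl`** ∕ **`torus_minOpL_submatrix_inl`**; **`torus_flucCov_apply`** (the fluctuation covariance entrywise: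
  `axEc b · axEc b′ · Â (b) (b′)` — needed at ORDER 2, where `Γ`'s live block enters the coarse second jet) and its matrix form **`torus_flucCov_eq`**.
WHAT IT IS NOT: NOT the dictionary's `hId₁` (it makes its left side explicit, `CoarseJetOrderOne`); NOT (T-ID), NOT SDF, NOT D1, NOT BetaPertH, NOT
continuum, NOT Clay; discharges NO binder of row D1 by itself; 0 estimates.  Unit `b2b-balaban-beta-d1-formalise-leaf-05` (gen 26), 2026-08-22.
-/

noncomputable section

open scoped BigOperators Matrix

namespace Summit.QuantumFields.BalabanUV.Beta.FP.RelInvPeriodisedMinOpRecord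

open Matrix
open Literature.Probability.LatticeModels (Torus.proj)
open Literature.MathematicalPhysics.QuantumFieldTheory.Balaban1983to89
open Literature.MathematicalPhysics.QuantumFieldTheory.Balaban1983to89.Beta
open Literature.MathematicalPhysics.QuantumFieldTheory.Balaban1983to89.Beta.Composition (kkt)
open Literature.MathematicalPhysics.QuantumFieldTheory.Balaban1983to89.Beta.CompositionSingular (effForm flucCov minOp minOpL)
open B6Lemma24Torus (pbox)
open AffineAveraging (Site box toSite)
open OneStepResolventKernel (Fib)
open OneStepKernelFamily (KInvStep)
open Summit.QuantumFields.BalabanUV.Beta.AxialDressingRooted (coDressKBmAt axEc axEc_inl_inl axEc_inr_inr IsCombBondAt)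
open Summit.QuantumFields.BalabanUV.Beta.BorderedHessian (bhKStepAt)
open Summit.QuantumFields.BalabanUV.Beta.SaddleInverse (regroup)
open Summit.QuantumFields.BalabanUV.Beta.FP.KernelPeriodisationFib (Idx perF)
open Summit.QuantumFields.BalabanUV.Beta.FP.TorusCombForest (baseOf axisOf)
open Summit.QuantumFields.BalabanUV.Beta.FP.TorusCombRows (Res combBondT combRowsT combBondT_eq baseOf_mem_pbox)
open Summit.QuantumFields.BalabanUV.Beta.FP.TorusCombSlots (CombSlot combSlotOf childOf combSlotOf_childOf combSlotOf_val combBondT_injective)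
open Summit.QuantumFields.BalabanUV.Beta.FP.RelInvPeriodisedMinOp (minOp_fromRows_apply_inl minOpL_fromRows_apply_inl flucCov_fromRows_apply
  torus_inv_kkt_of_slots_inl_inr
  torus_inv_kkt_of_slots_inr_inl torus_inv_kkt_of_slots_inl_inl)

/-! ## §3 At the presentation of record: the comb map, the live mask `axEc`, and the `μ`-columns ∕ `μ`-rows of `minOp` ∕ `minOpL` -/

section Record

variable {d : ℕ} {Lc : ℕ} [NeZero Lc] {r : Fin (d + 1) → ℕ} (M : Fin (d + 1) → ℕ) [∀ μ, NeZero (M μ)]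

omit [∀ μ, NeZero (M μ)] in
/-- [folklore] **THE COMB PRESENTATION OF RECORD** (the bookkeeping block of p314950's (E), stated once): on the box `M` (`Lc ∣ Mᵢ`, root
`r ∈ box (d+1) Lc`) there is an injective comb map `cb : Res (toSite r) Lc M → ↥(pbox M) × Fin (d+1)` such that leaf-06's comb rows read on the
field slots ARE the coordinate kills `τ₁ x b = [b = cb x]`, and an2's coarse axial coordinate indicator `axEc (toSite r) Lc` is the live reading:
`axEc p p = 1 ↔ (p is a non-comb field slot) ∨ (p is a presented coarse multiplier slot)` (for any `inr`-valued `fμ` with `hcoarse`). -/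
theorem comb_presentation (hr : r ∈ box (d + 1) Lc) (hM : ∀ i, Lc ∣ M i)
    {μ : Type*} (fμ : μ → Idx M (Fib d)) (hμ : ∀ a : μ, ∃ m : Fin (d + 1), (fμ a).2 = Sum.inr m)
    (hcoarse : ∀ (s : ↥(pbox M)) (m : Fin (d + 1)), ((s, Sum.inr m) : Idx M (Fib d)) ∈ Set.range fμ ↔ Torus.proj Lc (s : Site (d + 1)) = 0) :
    ∃ cb : Res (toSite r) Lc M → ↥(pbox M) × Fin (d + 1), Function.Injective cb ∧
      (combRowsT (toSite r) Lc M).submatrix id (fun b : ↥(pbox M) × Fin (d + 1) => ((b.1, Sum.inl b.2) : Idx M (Fib d)))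
          = Matrix.of (fun (x : Res (toSite r) Lc M) (b : ↥(pbox M) × Fin (d + 1)) => if b = cb x then (1 : ℝ) else 0) ∧
      (∀ p : Idx M (Fib d), axEc (toSite r) Lc p.1 p.1 p.2 p.2 = 1 ↔
        (∃ b : ↥(pbox M) × Fin (d + 1), b ∉ Set.range cb ∧ ((b.1, Sum.inl b.2) : Idx M (Fib d)) = p) ∨ p ∈ Set.range fμ) := by
  have hLc : 0 < Lc := Nat.pos_of_ne_zero (NeZero.ne Lc)
  have hρ : ∀ i, 0 ≤ toSite r i ∧ toSite r i < (Lc : ℤ) := fun i => by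
    have h := (Fintype.mem_piFinset.mp hr) i
    rw [Finset.mem_range] at h
    exact ⟨by simp only [toSite]; positivity, by simp only [toSite]; exact_mod_cast h⟩
  set fν : ↥(pbox M) × Fin (d + 1) → Idx M (Fib d) := fun b => (b.1, Sum.inl b.2) with hfν
  -- the comb map read in the field-slot index (p310903 ∕ p314950 verbatim): `fν (cb x) = combBondT x`
  let cb : Res (toSite r) Lc M → ↥(pbox M) × Fin (d + 1) := fun x =>
    (⟨baseOf (toSite r) Lc x.site, baseOf_mem_pbox hLc hρ hM x⟩, axisOf (toSite r) Lc x.site)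
  have hcbf : ∀ x, fν (cb x) = combBondT (toSite r) Lc M x := fun x => by rw [combBondT_eq hLc hρ hM x]
  have hfν_inj : Function.Injective fν := by
    rintro ⟨s, α⟩ ⟨s', α'⟩ h
    simp only [hfν, Prod.mk.injEq, Sum.inl.injEq] at h
    exact Prod.ext h.1 h.2
  have hcb : Function.Injective cb := fun x y h =>
    combBondT_injective hLc hρ hM (by rw [← hcbf, ← hcbf, h])
  have hτ : (combRowsT (toSite r) Lc M).submatrix id fν = Matrix.of fun x b => if b = cb x then (1 : ℝ) else 0 := by
    ext x b
    rw [submatrix_apply, of_apply, id, combRowsT, ← hcbf]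
    by_cases h : b = cb x
    · rw [if_pos (congrArg fν h), if_pos h]
    · rw [if_neg (fun e => h (hfν_inj e)), if_neg h]
  have hlive : ∀ p : Idx M (Fib d),
      axEc (toSite r) Lc p.1 p.1 p.2 p.2 = 1 ↔ (∃ b, b ∉ Set.range cb ∧ fν b = p) ∨ p ∈ Set.range fμ := by
    rintro ⟨s, α | m⟩
    · rw [axEc_inl_inl]
      constructor
      · intro h
        have hnc : ¬ IsCombBondAt (toSite r) Lc α (s : Site (d + 1)) := fun hc => by
          rw [if_neg (fun h3 => h3.2.2 hc)] at h; exact zero_ne_one h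
        refine Or.inl ⟨(s, α), ?_, rfl⟩
        rintro ⟨x, hx⟩
        have hslot := (combSlotOf (toSite r) Lc M hLc hρ hM x).2
        rw [combSlotOf_val, ← hcbf, hx] at hslot
        obtain ⟨m', hm', hc'⟩ := hslot
        have e : α = m' := Sum.inl_injective hm'
        subst e
        exact hnc hc'
      · rintro (⟨b, hb, hbp⟩ | ⟨a₁, ha⟩)
        · have hbs : b = (s, α) := hfν_inj hbp
          subst hbs
          have hnc : ¬ IsCombBondAt (toSite r) Lc α (s : Site (d + 1)) := fun hc => by
            apply hb
            let q : CombSlot (toSite r) Lc M := ⟨(s, Sum.inl α), α, rfl, hc⟩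
            refine ⟨childOf (toSite r) Lc M hLc hM q, hfν_inj ?_⟩
            rw [hcbf, ← combSlotOf_val hLc hρ hM, combSlotOf_childOf hLc hρ hM q]
          rw [if_pos ⟨rfl, rfl, hnc⟩]
        · obtain ⟨m, hm⟩ := hμ a₁
          rw [ha] at hm
          exact absurd hm Sum.inl_ne_inr
    · rw [axEc_inr_inr]
      constructor
      · intro h
        have hps : Torus.proj Lc (s : Site (d + 1)) = 0 := by
          by_contra hc
          rw [if_neg (fun h3 => hc h3.2.2)] at h; exact zero_ne_one h
        exact Or.inr ((hcoarse s m).2 hps)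
      · rintro (⟨b, -, hbp⟩ | ha)
        · exact absurd (congrArg Prod.snd hbp) Sum.inl_ne_inr
        · rw [if_pos ⟨rfl, rfl, (hcoarse s m).1 ha⟩]
  exact ⟨cb, hcb, hτ, hlive⟩

omit [NeZero Lc] [∀ μ, NeZero (M μ)] in
/-- [folklore] **THE COMB MASK IS an2's LIVE INDICATOR**: under the live reading of `comb_presentation`, for a field slot `(s, α)` and any real `X`,
`(if (s, α) ∈ range cb then 0 else X) = axEc (toSite r) Lc s s (inl α) (inl α) · X`. -/
theorem comb_mask_eq_axEc_mul {μ : Type*} {fμ : μ → Idx M (Fib d)} (hμ : ∀ a : μ, ∃ m : Fin (d + 1), (fμ a).2 = Sum.inr m)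
    {cb : Res (toSite r) Lc M → ↥(pbox M) × Fin (d + 1)}
    (hlive : ∀ p : Idx M (Fib d), axEc (toSite r) Lc p.1 p.1 p.2 p.2 = 1 ↔
        (∃ b : ↥(pbox M) × Fin (d + 1), b ∉ Set.range cb ∧ ((b.1, Sum.inl b.2) : Idx M (Fib d)) = p) ∨ p ∈ Set.range fμ)
    (s : ↥(pbox M)) (α : Fin (d + 1)) (X : ℝ) :
    (if ((s, α) : ↥(pbox M) × Fin (d + 1)) ∈ Set.range cb then 0 else X)
      = axEc (toSite r) Lc (s : Site (d + 1)) (s : Site (d + 1)) (Sum.inl α) (Sum.inl α) * X := by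
  classical
  have key : ((s, α) : ↥(pbox M) × Fin (d + 1)) ∉ Set.range cb ↔
      axEc (toSite r) Lc (s : Site (d + 1)) (s : Site (d + 1)) (Sum.inl α) (Sum.inl α) = 1 := by
    rw [hlive ((s, Sum.inl α) : Idx M (Fib d))]
    constructor
    · intro h; exact Or.inl ⟨(s, α), h, rfl⟩
    · rintro (⟨b, hb, hbp⟩ | ⟨a, ha⟩)
      · have hbs : b = (s, α) := by
          simp only [Prod.mk.injEq, Sum.inl.injEq] at hbp
          exact Prod.ext hbp.1 hbp.2
        rw [hbs] at hb; exact hb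
      · obtain ⟨m, hm⟩ := hμ a; rw [ha] at hm; exact absurd hm Sum.inl_ne_inr
  have h01 : axEc (toSite r) Lc (s : Site (d + 1)) (s : Site (d + 1)) (Sum.inl α) (Sum.inl α) = 1 ∨
      axEc (toSite r) Lc (s : Site (d + 1)) (s : Site (d + 1)) (Sum.inl α) (Sum.inl α) = 0 := by
    rw [axEc_inl_inl]; split_ifs
    · exact Or.inl rfl
    · exact Or.inr rfl
  by_cases h : ((s, α) : ↥(pbox M) × Fin (d + 1)) ∈ Set.range cb
  · rw [if_pos h]
    rcases h01 with h1 | h0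
    · exact absurd (key.2 h1) (not_not.2 h)
    · rw [h0, zero_mul]
  · rw [if_neg h, key.1 h, one_mul]

set_option synthInstance.maxSize 1024 in
/-- **[folklore] THE `μ`-COLUMNS OF THE MINIMISER OF THE COMB-SLICED PERIODISED LEVEL-`j` SYSTEM** (presentation of record: fields `(s, α) ↦ (s, inl α)`,
`τ₁ := combRowsT (toSite r) Lc M` on the field slots, coarse multipliers by any injective `inr`-valued `fμ` with `hcoarse`):
`minOp H₀ [Q₁₀;τ₁] (s, α) (inl a) = axEc (toSite r) Lc s s (inl α) (inl α) · Â ((s, inl α)) (fμ a)`,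
`Â := perF M (coDressKBmAt (toSite r) Lc (KInvStep Lc j))` — `+Â` on the non-comb field slots, `0` on the comb slots. -/
theorem torus_minOp_inl (hr : r ∈ box (d + 1) Lc) (hM : ∀ i, Lc ∣ M i) (j : ℕ)
    {μ : Type*} [Fintype μ] [DecidableEq μ] (fμ : μ → Idx M (Fib d)) (hfμ : Function.Injective fμ)
    (hμ : ∀ a : μ, ∃ m : Fin (d + 1), (fμ a).2 = Sum.inr m)
    (hcoarse : ∀ (s : ↥(pbox M)) (m : Fin (d + 1)), ((s, Sum.inr m) : Idx M (Fib d)) ∈ Set.range fμ ↔ Torus.proj Lc (s : Site (d + 1)) = 0)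
    (b : ↥(pbox M) × Fin (d + 1)) (a : μ) :
    minOp ((perF M (bhKStepAt d (toSite r) Lc j)).submatrix (fun b : ↥(pbox M) × Fin (d + 1) => ((b.1, Sum.inl b.2) : Idx M (Fib d)))
          (fun b : ↥(pbox M) × Fin (d + 1) => ((b.1, Sum.inl b.2) : Idx M (Fib d))))
        (fromRows
          ((perF M (bhKStepAt d (toSite r) Lc j)).submatrix fμ (fun b : ↥(pbox M) × Fin (d + 1) => ((b.1, Sum.inl b.2) : Idx M (Fib d))))
          ((combRowsT (toSite r) Lc M).submatrix id (fun b : ↥(pbox M) × Fin (d + 1) => ((b.1, Sum.inl b.2) : Idx M (Fib d)))))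
        b (Sum.inl a)
      = axEc (toSite r) Lc (b.1 : Site (d + 1)) (b.1 : Site (d + 1)) (Sum.inl b.2) (Sum.inl b.2)
          * perF M (coDressKBmAt (toSite r) Lc (KInvStep (d := d) Lc j)) (b.1, Sum.inl b.2) (fμ a) := by
  obtain ⟨cb, hcb, hτ, hlive⟩ := comb_presentation M hr hM fμ hμ hcoarse
  have hfν_inj : Function.Injective (fun b : ↥(pbox M) × Fin (d + 1) => ((b.1, Sum.inl b.2) : Idx M (Fib d))) := by
    rintro ⟨s, α⟩ ⟨s', α'⟩ h
    simp only [Prod.mk.injEq, Sum.inl.injEq] at h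
    exact Prod.ext h.1 h.2
  rw [minOp_fromRows_apply_inl, hτ,
    torus_inv_kkt_of_slots_inl_inr M hr hM j _ fμ hfν_inj hfμ (fun b => ⟨b.2, rfl⟩) hμ cb hcb hlive b a]
  exact comb_mask_eq_axEc_mul M hμ hlive b.1 b.2 _

set_option synthInstance.maxSize 1024 in
/-- **[folklore] THE `μ`-ROWS OF THE LEFT COMPANION `minOpL`** (same presentation):
`minOpL H₀ [Q₁₀;τ₁] (inl a) (s, α) = −(axEc (toSite r) Lc s s (inl α) (inl α) · Â (fμ a) ((s, inl α)))`. -/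
theorem torus_minOpL_inl (hr : r ∈ box (d + 1) Lc) (hM : ∀ i, Lc ∣ M i) (j : ℕ)
    {μ : Type*} [Fintype μ] [DecidableEq μ] (fμ : μ → Idx M (Fib d)) (hfμ : Function.Injective fμ)
    (hμ : ∀ a : μ, ∃ m : Fin (d + 1), (fμ a).2 = Sum.inr m)
    (hcoarse : ∀ (s : ↥(pbox M)) (m : Fin (d + 1)), ((s, Sum.inr m) : Idx M (Fib d)) ∈ Set.range fμ ↔ Torus.proj Lc (s : Site (d + 1)) = 0)
    (a : μ) (b : ↥(pbox M) × Fin (d + 1)) :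
    minOpL ((perF M (bhKStepAt d (toSite r) Lc j)).submatrix (fun b : ↥(pbox M) × Fin (d + 1) => ((b.1, Sum.inl b.2) : Idx M (Fib d)))
          (fun b : ↥(pbox M) × Fin (d + 1) => ((b.1, Sum.inl b.2) : Idx M (Fib d))))
        (fromRows
          ((perF M (bhKStepAt d (toSite r) Lc j)).submatrix fμ (fun b : ↥(pbox M) × Fin (d + 1) => ((b.1, Sum.inl b.2) : Idx M (Fib d))))
          ((combRowsT (toSite r) Lc M).submatrix id (fun b : ↥(pbox M) × Fin (d + 1) => ((b.1, Sum.inl b.2) : Idx M (Fib d)))))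
        (Sum.inl a) b
      = -(axEc (toSite r) Lc (b.1 : Site (d + 1)) (b.1 : Site (d + 1)) (Sum.inl b.2) (Sum.inl b.2)
          * perF M (coDressKBmAt (toSite r) Lc (KInvStep (d := d) Lc j)) (fμ a) (b.1, Sum.inl b.2)) := by
  obtain ⟨cb, hcb, hτ, hlive⟩ := comb_presentation M hr hM fμ hμ hcoarse
  have hfν_inj : Function.Injective (fun b : ↥(pbox M) × Fin (d + 1) => ((b.1, Sum.inl b.2) : Idx M (Fib d))) := by
    rintro ⟨s, α⟩ ⟨s', α'⟩ h
    simp only [Prod.mk.injEq, Sum.inl.injEq] at h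
    exact Prod.ext h.1 h.2
  rw [minOpL_fromRows_apply_inl, hτ,
    torus_inv_kkt_of_slots_inr_inl M hr hM j _ fμ hfν_inj hfμ (fun b => ⟨b.2, rfl⟩) hμ cb hcb hlive a b, ← mul_neg]
  exact comb_mask_eq_axEc_mul M hμ hlive b.1 b.2 _

set_option synthInstance.maxSize 1024 in
/-- **[folklore] MATRIX FORM: the `μ`-COLUMN BLOCK of the minimiser** — `(minOp H₀ [Q₁₀;τ₁]).submatrix id inl = of (fun (s,α) a ↦ axEc s s α α · Â (s, inl α) (fμ a))`. -/
theorem torus_minOp_submatrix_inl (hr : r ∈ box (d + 1) Lc) (hM : ∀ i, Lc ∣ M i) (j : ℕ)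
    {μ : Type*} [Fintype μ] [DecidableEq μ] (fμ : μ → Idx M (Fib d)) (hfμ : Function.Injective fμ)
    (hμ : ∀ a : μ, ∃ m : Fin (d + 1), (fμ a).2 = Sum.inr m)
    (hcoarse : ∀ (s : ↥(pbox M)) (m : Fin (d + 1)), ((s, Sum.inr m) : Idx M (Fib d)) ∈ Set.range fμ ↔ Torus.proj Lc (s : Site (d + 1)) = 0) :
    (minOp ((perF M (bhKStepAt d (toSite r) Lc j)).submatrix (fun b : ↥(pbox M) × Fin (d + 1) => ((b.1, Sum.inl b.2) : Idx M (Fib d)))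
          (fun b : ↥(pbox M) × Fin (d + 1) => ((b.1, Sum.inl b.2) : Idx M (Fib d))))
        (fromRows
          ((perF M (bhKStepAt d (toSite r) Lc j)).submatrix fμ (fun b : ↥(pbox M) × Fin (d + 1) => ((b.1, Sum.inl b.2) : Idx M (Fib d))))
          ((combRowsT (toSite r) Lc M).submatrix id (fun b : ↥(pbox M) × Fin (d + 1) => ((b.1, Sum.inl b.2) : Idx M (Fib d)))))).submatrix
        id Sum.inl
      = Matrix.of fun (b : ↥(pbox M) × Fin (d + 1)) (a : μ) =>
          axEc (toSite r) Lc (b.1 : Site (d + 1)) (b.1 : Site (d + 1)) (Sum.inl b.2) (Sum.inl b.2)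
            * perF M (coDressKBmAt (toSite r) Lc (KInvStep (d := d) Lc j)) (b.1, Sum.inl b.2) (fμ a) := by
  ext b a
  rw [submatrix_apply, of_apply, id]
  exact torus_minOp_inl M hr hM j fμ hfμ hμ hcoarse b a

set_option synthInstance.maxSize 1024 in
/-- **[folklore] MATRIX FORM: the `μ`-ROW BLOCK of the left companion** — `(minOpL H₀ [Q₁₀;τ₁]).submatrix inl id = −of (fun a (s,α) ↦ axEc s s α α · Â (fμ a) (s, inl α))`. -/
theorem torus_minOpL_submatrix_inl (hr : r ∈ box (d + 1) Lc) (hM : ∀ i, Lc ∣ M i) (j : ℕ)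
    {μ : Type*} [Fintype μ] [DecidableEq μ] (fμ : μ → Idx M (Fib d)) (hfμ : Function.Injective fμ)
    (hμ : ∀ a : μ, ∃ m : Fin (d + 1), (fμ a).2 = Sum.inr m)
    (hcoarse : ∀ (s : ↥(pbox M)) (m : Fin (d + 1)), ((s, Sum.inr m) : Idx M (Fib d)) ∈ Set.range fμ ↔ Torus.proj Lc (s : Site (d + 1)) = 0) :
    (minOpL ((perF M (bhKStepAt d (toSite r) Lc j)).submatrix (fun b : ↥(pbox M) × Fin (d + 1) => ((b.1, Sum.inl b.2) : Idx M (Fib d)))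
          (fun b : ↥(pbox M) × Fin (d + 1) => ((b.1, Sum.inl b.2) : Idx M (Fib d))))
        (fromRows
          ((perF M (bhKStepAt d (toSite r) Lc j)).submatrix fμ (fun b : ↥(pbox M) × Fin (d + 1) => ((b.1, Sum.inl b.2) : Idx M (Fib d))))
          ((combRowsT (toSite r) Lc M).submatrix id (fun b : ↥(pbox M) × Fin (d + 1) => ((b.1, Sum.inl b.2) : Idx M (Fib d)))))).submatrix
        Sum.inl id
      = -Matrix.of fun (a : μ) (b : ↥(pbox M) × Fin (d + 1)) =>
          axEc (toSite r) Lc (b.1 : Site (d + 1)) (b.1 : Site (d + 1)) (Sum.inl b.2) (Sum.inl b.2)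
            * perF M (coDressKBmAt (toSite r) Lc (KInvStep (d := d) Lc j)) (fμ a) (b.1, Sum.inl b.2) := by
  ext a b
  rw [submatrix_apply, neg_apply, of_apply, id]
  exact torus_minOpL_inl M hr hM j fμ hfμ hμ hcoarse a b

set_option synthInstance.maxSize 1024 in
/-- **[folklore] THE FLUCTUATION COVARIANCE OF THE COMB-SLICED PERIODISED LEVEL-`j` SYSTEM, ENTRYWISE** (same presentation):
`flucCov H₀ [Q₁₀;τ₁] (s,α) (s',α') = axEc s s (inl α) (inl α) · axEc s' s' (inl α') (inl α') · Â (s, inl α) (s', inl α')` — `+Â` between non-comb field slots,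
`0` as soon as one slot is on the comb. -/
theorem torus_flucCov_apply (hr : r ∈ box (d + 1) Lc) (hM : ∀ i, Lc ∣ M i) (j : ℕ)
    {μ : Type*} [Fintype μ] [DecidableEq μ] (fμ : μ → Idx M (Fib d)) (hfμ : Function.Injective fμ)
    (hμ : ∀ a : μ, ∃ m : Fin (d + 1), (fμ a).2 = Sum.inr m)
    (hcoarse : ∀ (s : ↥(pbox M)) (m : Fin (d + 1)), ((s, Sum.inr m) : Idx M (Fib d)) ∈ Set.range fμ ↔ Torus.proj Lc (s : Site (d + 1)) = 0)
    (b b' : ↥(pbox M) × Fin (d + 1)) :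
    flucCov ((perF M (bhKStepAt d (toSite r) Lc j)).submatrix (fun b : ↥(pbox M) × Fin (d + 1) => ((b.1, Sum.inl b.2) : Idx M (Fib d)))
          (fun b : ↥(pbox M) × Fin (d + 1) => ((b.1, Sum.inl b.2) : Idx M (Fib d))))
        (fromRows
          ((perF M (bhKStepAt d (toSite r) Lc j)).submatrix fμ (fun b : ↥(pbox M) × Fin (d + 1) => ((b.1, Sum.inl b.2) : Idx M (Fib d))))
          ((combRowsT (toSite r) Lc M).submatrix id (fun b : ↥(pbox M) × Fin (d + 1) => ((b.1, Sum.inl b.2) : Idx M (Fib d)))))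
        b b'
      = axEc (toSite r) Lc (b.1 : Site (d + 1)) (b.1 : Site (d + 1)) (Sum.inl b.2) (Sum.inl b.2)
          * (axEc (toSite r) Lc (b'.1 : Site (d + 1)) (b'.1 : Site (d + 1)) (Sum.inl b'.2) (Sum.inl b'.2)
            * perF M (coDressKBmAt (toSite r) Lc (KInvStep (d := d) Lc j)) (b.1, Sum.inl b.2) (b'.1, Sum.inl b'.2)) := by
  classical
  obtain ⟨cb, hcb, hτ, hlive⟩ := comb_presentation M hr hM fμ hμ hcoarse
  have hfν_inj : Function.Injective (fun b : ↥(pbox M) × Fin (d + 1) => ((b.1, Sum.inl b.2) : Idx M (Fib d))) := by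
    rintro ⟨s, α⟩ ⟨s', α'⟩ h
    simp only [Prod.mk.injEq, Sum.inl.injEq] at h
    exact Prod.ext h.1 h.2
  rw [flucCov_fromRows_apply, hτ,
    torus_inv_kkt_of_slots_inl_inl M hr hM j _ fμ hfν_inj hfμ (fun b => ⟨b.2, rfl⟩) hμ cb hcb hlive b b',
    ← comb_mask_eq_axEc_mul M hμ hlive b'.1 b'.2, ← comb_mask_eq_axEc_mul M hμ hlive b.1 b.2]
  by_cases h : b ∈ Set.range cb
  · rw [if_pos (Or.inl h), if_pos h]
  · rw [if_neg h]
    by_cases h' : b' ∈ Set.range cb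
    · rw [if_pos (Or.inr h'), if_pos h']
    · rw [if_neg (not_or.2 ⟨h, h'⟩), if_neg h']

set_option synthInstance.maxSize 1024 in
/-- **[folklore] MATRIX FORM: the FLUCTUATION COVARIANCE** — `flucCov H₀ [Q₁₀;τ₁] = of (fun (s,α) (s',α') ↦ axEc s s α α · (axEc s' s' α' α' · Â (s, inl α) (s', inl α')))`. -/
theorem torus_flucCov_eq (hr : r ∈ box (d + 1) Lc) (hM : ∀ i, Lc ∣ M i) (j : ℕ)
    {μ : Type*} [Fintype μ] [DecidableEq μ] (fμ : μ → Idx M (Fib d)) (hfμ : Function.Injective fμ)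
    (hμ : ∀ a : μ, ∃ m : Fin (d + 1), (fμ a).2 = Sum.inr m)
    (hcoarse : ∀ (s : ↥(pbox M)) (m : Fin (d + 1)), ((s, Sum.inr m) : Idx M (Fib d)) ∈ Set.range fμ ↔ Torus.proj Lc (s : Site (d + 1)) = 0) :
    flucCov ((perF M (bhKStepAt d (toSite r) Lc j)).submatrix (fun b : ↥(pbox M) × Fin (d + 1) => ((b.1, Sum.inl b.2) : Idx M (Fib d)))
          (fun b : ↥(pbox M) × Fin (d + 1) => ((b.1, Sum.inl b.2) : Idx M (Fib d))))
        (fromRows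
          ((perF M (bhKStepAt d (toSite r) Lc j)).submatrix fμ (fun b : ↥(pbox M) × Fin (d + 1) => ((b.1, Sum.inl b.2) : Idx M (Fib d))))
          ((combRowsT (toSite r) Lc M).submatrix id (fun b : ↥(pbox M) × Fin (d + 1) => ((b.1, Sum.inl b.2) : Idx M (Fib d)))))
      = Matrix.of fun (b b' : ↥(pbox M) × Fin (d + 1)) =>
          axEc (toSite r) Lc (b.1 : Site (d + 1)) (b.1 : Site (d + 1)) (Sum.inl b.2) (Sum.inl b.2)
            * (axEc (toSite r) Lc (b'.1 : Site (d + 1)) (b'.1 : Site (d + 1)) (Sum.inl b'.2) (Sum.inl b'.2)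
              * perF M (coDressKBmAt (toSite r) Lc (KInvStep (d := d) Lc j)) (b.1, Sum.inl b.2) (b'.1, Sum.inl b'.2)) := by
  ext b b'
  rw [of_apply]
  exact torus_flucCov_apply M hr hM j fμ hfμ hμ hcoarse b b'

end Record

end Summit.QuantumFields.BalabanUV.Beta.FP.RelInvPeriodisedMinOpRecord

end
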